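import Summits.Schanuel.Schanuel.Theorems.ZilberEacParamFibreCurveFlat
import HarnessLib

/-!
# Polynomially parametrised base curves, LI: the RESIDUAL fibre-curve class over polynomial
# curves, typed — the equimodular class

HONEST FRAMING.  Cell `pub-schanuel` (Zilber's Exponential-Algebraic Closedness, case ladder;
host summit Schanuel), seat 2, gen 21.  A census theorem, no new analysis: if a fibre-curve
surface `S(g; Q)` (`Q ∈ ℂ[t, y₀]` irreducible with two `y₀`-degrees) over a polynomial curve
`(g₀, g₁)` with `2 ≤ d = deg g₀ < n = deg g₁` does NOT have Zariski-dense exponential points, then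
(`paramFibreCurve_residual_of_not_unprojectedDense`): (i) `d ∣ n`; (ii) the phase
`Re(lc(g₁)(i/lc(g₀))^{n/d})` vanishes; (iii) NO gap: `deg(lc(g₀)^e g₁ - lc(g₁) g₀^e) ≤ n - d`;
(iv) the top `t`-row of `supp Q` reaches the rightmost `y₀`-column and (v) the leftmost one;
(vi) EVERY nonzero root `θ` of the top-row polynomial `Q₀` lies on the EQUIMODULAR circle
`Λ(θ) = 0`, `Λ(θ) = e Re(c i^{e-1}) log ‖θ‖ + Re(D_{n-d} i^{e-1}/lc(g₀)^{e-1})` (canonical `c`, `D`).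
These are the contrapositives of files XXI (gen 20), XL, XLIII, L.  The class (i)–(vi) is the exact
analogue of gen 18's residual over graph bases (`fibreCurveSurface_residual_of_not_unprojectedDense`);
deciding it is a value-distribution problem for `e^{g₁(t)}` along the zeros (Shapiro/Schanuel-type in
its totally degenerate members) — OPEN.  Mantova–Masser's question is OPEN in general
(PLMS 2024 §1 p. 5); NOT Schanuel's conjecture (neither used nor implied; EAC ⇏ SC).
-/

noncomputable section

open Filter Topology Set Complex MvPolynomial
open Literature.NumberTheory.Transcendental Literature.ModelTheory.Zilber
open Literature.ModelTheory.ExponentialFields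

set_option linter.dupNamespace false

namespace Summit.Schanuel.Schanuel.Theorems

variable (g₀ g₁ : Polynomial ℂ) {Q : MvPolynomial (Fin 3) ℂ}

/-- **The residual fibre-curve class over a polynomial curve (`2 ≤ d < n`), typed.**  See the module
docstring. [cite: MantovaMasser2023, §1 Further remarks, p. 5 (the question, open in general)]
(new) -/
theorem paramFibreCurve_residual_of_not_unprojectedDense (hd : 2 ≤ g₀.natDegree)
    (hlt : g₀.natDegree < g₁.natDegree) (hirr : Irreducible Q) (hQ2 : ∀ m ∈ Q.support, m 2 = 0)
    (h1 : ∃ m ∈ Q.support, ∃ m' ∈ Q.support, m 1 ≠ m' 1)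
    (hnot : ¬ UnprojectedDense {w : Fin 2 ⊕ Fin 2 → ℂ | ∃ t : ℂ, w (Sum.inl 0) = g₀.eval t ∧
      w (Sum.inl 1) = g₁.eval t ∧
      MvPolynomial.eval (Fin.cases t (fun i => w (Sum.inr i)) : Fin 3 → ℂ) Q = 0}) :
    g₀.natDegree ∣ g₁.natDegree ∧
    (g₁.leadingCoeff * (I / g₀.leadingCoeff) ^ (g₁.natDegree / g₀.natDegree)).re = 0 ∧
    (Polynomial.C (g₀.leadingCoeff ^ (g₁.natDegree / g₀.natDegree)) * g₁ -
        Polynomial.C g₁.leadingCoeff * g₀ ^ (g₁.natDegree / g₀.natDegree)).natDegree +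
      g₀.natDegree ≤ g₁.natDegree ∧
    (∀ m₀ ∈ Q.support, (∀ m ∈ Q.support, m 0 ≤ m₀ 0) →
      (∀ m ∈ Q.support, m 0 = m₀ 0 → m 1 ≤ m₀ 1) → ∀ m ∈ Q.support, m 1 ≤ m₀ 1) ∧
    (∀ m₀ ∈ Q.support, (∀ m ∈ Q.support, m 0 ≤ m₀ 0) →
      (∀ m ∈ Q.support, m 0 = m₀ 0 → m₀ 1 ≤ m 1) → ∀ m ∈ Q.support, m₀ 1 ≤ m 1) ∧
    (∀ N₀ : ℕ, (∀ m ∈ Q.support, m 0 ≤ N₀) → ∀ ma ∈ Q.support, ma 0 = N₀ → ∀ θ : ℂ, θ ≠ 0 →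
      (∑ m ∈ Q.support.filter (fun m : Fin 3 →₀ ℕ => m 0 = N₀),
        Polynomial.C (Q.coeff m) * Polynomial.X ^ (m 1)).eval θ = 0 →
      ((g₁.natDegree / g₀.natDegree : ℕ) : ℝ) *
          (g₁.leadingCoeff / g₀.leadingCoeff ^ (g₁.natDegree / g₀.natDegree) *
            I ^ (g₁.natDegree / g₀.natDegree - 1)).re * Real.log ‖θ‖ +
        ((Polynomial.C ((g₀.leadingCoeff ^ (g₁.natDegree / g₀.natDegree))⁻¹) *
            (Polynomial.C (g₀.leadingCoeff ^ (g₁.natDegree / g₀.natDegree)) * g₁ -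
              Polynomial.C g₁.leadingCoeff * g₀ ^ (g₁.natDegree / g₀.natDegree))).coeff
            (g₀.natDegree * (g₁.natDegree / g₀.natDegree - 1)) *
          I ^ (g₁.natDegree / g₀.natDegree - 1) /
          g₀.leadingCoeff ^ (g₁.natDegree / g₀.natDegree - 1)).re = 0) := by
  have hn : 1 ≤ g₁.natDegree := by omega
  -- (i), (ii): file XXI
  have h12 : g₀.natDegree ∣ g₁.natDegree ∧
      (g₁.leadingCoeff * (I / g₀.leadingCoeff) ^ (g₁.natDegree / g₀.natDegree)).re = 0 := by
    by_contra h
    rw [not_and_or] at h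
    exact hnot (unprojectedDense_paramSurface₃_of_y0 g₀ g₁ hd hn h hirr hQ2 h1)
  refine ⟨h12.1, h12.2, ?_, ?_, ?_, ?_⟩
  · -- (iii): file XL
    by_contra h
    exact hnot (unprojectedDense_paramSurface₃_of_y0_gap_canonical g₀ g₁ hd hn h12.1 h12.2 (by omega)
      hirr hQ2 h1)
  · -- (iv): file XLIII, right
    intro m₀ hm₀ htop hrow m hm
    by_contra h
    exact hnot (unprojectedDense_paramSurface₃_of_y0_topRight g₀ g₁ hd hlt hirr hQ2 hm₀ htop hrow
      ⟨m, hm, by omega⟩)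
  · -- (v): file XLIII, left
    intro m₀ hm₀ htop hrow m hm
    by_contra h
    exact hnot (unprojectedDense_paramSurface₃_of_y0_topLeft g₀ g₁ hd hlt hirr hQ2 hm₀ htop hrow
      ⟨m, hm, by omega⟩)
  · -- (vi): file L
    intro N₀ hN₀ ma hma hma0 θ hθ0 hθ
    by_contra h
    exact hnot (unprojectedDense_paramSurface₃_of_y0_topRow g₀ g₁ hd hlt hirr hQ2 N₀ hN₀ hma hma0 h1
      hθ0 hθ h)

end Summit.Schanuel.Schanuel.Theorems
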